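import Literature.NumberTheory.EllipticCurves.LocalKummerLineParametrisation
import Literature.NumberTheory.EllipticCurves.CasselsTateLocalTermLine
import Literature.NumberTheory.EllipticCurves.CasselsTateFirstCase
import Literature.NumberTheory.EllipticCurves.CasselsTateSelmerKolyvaginValue
import Literature.NumberTheory.EllipticCurves.KummerImageIsotropyProofs
import Literature.NumberTheory.GaloisCohomology.ArchimedeanInvariantMap
import HarnessLib

/-!
# McCallum's Lemma 5.3 at `p = 2` for a CM curve, ON FIRST-CASE DATA: of the local Cassels–Tate terms at a
# Kolyvagin place over `t` and over `[ω] t`, NOT BOTH vanish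

Topic `NumberTheory/EllipticCurves`; namespace `Literature.NumberTheory.EllipticCurves`. THEOREMS ONLY: **no definition
and no named fact** (D-0026). Item (κ3) «the D/D′ instantiation» of SPEC-K-TY § (T-L2′ LOCAL): the assembly of
#40 `ctLocalTerm_ne_zero_or_of_line` (the `ℤ[ω]/2^{2κ}`-LINE form of McCallum's Lemma 5.3), #41
`mem_kummerLocalConditionAt_of_forall_inv_weilLocalCup_eq_zero` (`𝓛_v^⊥ ⊆ 𝓛_v`), the local Kummer parametrisation
`JZero.exists_kummerLocal_line_parametrisation` (κ2) and the tree's isotropy theorem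
`kummerClass_cupProduct_kummerClass_eq_zero_holds`, on Milne's first-case data `FirstCaseData W m` (level `m = 2^κ`,
auxiliary level `m²`) at a finite place `v₀ ∤ 2` with `E[m²] ⊆ E(K_{v₀})`, for `inv` THE invariant maps
(`LocalInvariants.canonical`).

* `map_one_eq_resH1Hom_of_eq` — `H¹(F) = resH1Hom (id, fn)` on `H¹(K, E[n])` when `F` has points map `fn` (bridge
  between the `GaloisRepresentations` functoriality and the tree's `resH1Hom`, the RESIDUE's `w_X`).
* `map_inclKD_map_one_eq`, `map_mulK_map_one_eq_restrictField` — the two naturality squares `ι ∘ F₁ = F₂ ∘ ι`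
  (global) and `[m] ∘ F₂ = F₁ ∘ [m]` (over a `K`-field) on `H¹`, for intertwining maps `F₁` of `E[m]`, `F₂` of
  `E[m²]` over one `f`.
* ★ `FirstCaseData.localTerm_ne_zero_or_of_line` — `E = W/K` elliptic over a number field, `m = 2^κ` (`κ ≥ 1`),
  `v₀ ∤ 2` with `Γ_{K_{v₀}}` fixing `E[m²](K̄)`; `f` a `Γ_K`-equivariant operator of `E(K̄)` with `f² + f + 1 = 0` and a local
  points map `f_{v₀}`; `fn` its points map on `E[m²]` (equivariant), `w := resH1Hom (id, fn)` on `H¹(K, E[m²])`; a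
  Weil datum `e` (alternating, non-degenerate); `D, D'` first-case data with the SAME `b₁` and `ι_* D.b' = t`,
  `ι_* D'.b' = w t`; exponents with `2^a • res_{v₀} b₁ ∉ 𝓛_{v₀}`, `2^b • t ∉ ker (H¹(K, E[m²]) → H¹(K_{v₀}, E[m²]))`,
  `κ ≤ a + b + 1`.  THEN `D.localTerm (canonical) v₀ ≠ 0 ∨ D'.localTerm (canonical) v₀ ≠ 0`.
  Proof: `κ Z = β'_D` (κ2, onto); `2^{κ+b} • κ Z ≠ 0` (`mul_zsmul_ne_zero_of_map_mulK_eq_res`); #40 gives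
  `t(b₁; β_D, κ Z) ≠ 0 ∨ t(b₁; β_{D'}, κ (fn Z)) ≠ 0`; the first is `D.localTerm`, the second is `D'.localTerm` by
  `ctLocalTerm_congr_right`, since `[m]_* κ(fn Z) = [m]_* H¹(F₂)(β'_D) = H¹(F₁)([m]_* β'_D) = H¹(F₁)(res b'_D)
  = res (H¹(F₁) b'_D)` and `res b'_{D'} = res (H¹(F₁) b'_D)` because `ι_*` is injective over `K_{v₀}`
  (`map_inclKD_restrictField_injective_of_forall_smul_eq`, `E[m²] ⊆ E(K_{v₀})`) and both map to `res (w t)`.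

* ★★ `FirstCaseData.false_of_forall_localTerm_eq_zero_of_line` — the leaf IN ITS DISPLAYED SHAPE
  «(∀ D over t, t_{v₀}(D) = 0) → (∀ D′ over [ω] t, t_{v₀}(D′) = 0) → False», the existence of `D`, `D′` supplied
  (tree `exists_firstCaseData_of_zsmul_of_map_mulK_eq_zero`) from `m • b₁`, `t`, `[ω] t` Selmer, `2^{N'} t = 0`
  (`N' ≤ κ`) and `E(K)[m]^{Γ_K} = 0`.
What the caller (RESIDUE c v3 l.141–169, `b₁ := 2^{j-κ} • c_X(ℓm)`) still supplies: the FLIP turning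
`2^{a+(j-N')} • c_Y(m) ∉ ker loc_λ` into `2^{a+κ-N'} • res_λ b₁ ∉ 𝓛_λ` (then `κ ≤ (a+κ-N') + b + 1`), `[ω] t` Selmer
(`resH1Hom_id_mem_selmerGroup`), `E(K)[m]^{Γ_K} = 0` (`HuShuYin2019.cubeSumCurve_geomTorsion_eq_zero_of_forall_smul_eq`),
and the operator data `f = φ_X`, `f_{v₀}` (`Isogeny.hasLocalPointsMaps_toAddMonoidHom`), `fn = fn_X`.

References: [McCallumLMS1991] W. G. McCallum, *Kolyvagin's work on Shafarevich–Tate groups*, LMS LN 153 (1991), §4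
Prop. 4.4 and Prop. 4.7, §5 Lemma 5.3 and the proof of Thm. 5.4; [MilneADT2006] J. S. Milne, *ADT*, 2nd ed., I §6 proof
of Prop. 6.9, Cor. 2.3; [Rubin1999] K. Rubin, LNM 1716, Cor. 5.5; [SerreGaloisCohomology1997] J.-P. Serre, *Galois
Cohomology*, I.§2.4.
-/

noncomputable section

open scoped Classical

universe u

namespace Literature.NumberTheory.EllipticCurves

open _root_.WeierstrassCurve Field Function NumberField IsDedekindDomain
open Literature.NumberTheory.GaloisRepresentations Literature.NumberTheory.GaloisCohomology
open Literature.NumberTheory.GaloisRepresentations.DiscreteGaloisModule (mu)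
open scoped ContRepresentation

/-! ## Functoriality bookkeeping on `H¹(K, E[m])`, `H¹(K, E[m²])` -/

section Functoriality

variable {K : Type u} [Field K] (W : WeierstrassCurve K) (m : ℕ)

/-- **`H¹(F) = resH1Hom (id, fn)`** on `H¹(K, E[n])` for an intertwining map `F` of `E[n]` with points map `fn` (both are
`[β] ↦ [fn ∘ β]`). [cite: SerreGaloisCohomology1997, I.§2.4] -/
theorem map_one_eq_resH1Hom_of_eq {n : ℤ}
    (F : (W.torsionGaloisModule n).toContRepresentation →ⁱL (W.torsionGaloisModule n).toContRepresentation)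
    (fn : geomTorsion W n →+ geomTorsion W n)
    (hfn : ∀ (σ : absoluteGaloisGroup K) (P : geomTorsion W n), fn (ContinuousMonoidHom.id _ σ • P) = σ • fn P)
    (hF : ∀ P, F P = fn P) (c : galoisCohomology (W.torsionGaloisModule n) 1) :
    galoisCohomology.map F 1 c = resH1Hom (ContinuousMonoidHom.id _) fn hfn c := by
  obtain rfl : F.toContinuousLinearMap.toLinearMap.toAddMonoidHom = fn := AddMonoidHom.ext hF
  obtain ⟨β, rfl⟩ := oneCocycleClass_surjective _ c
  rw [galoisCohomology.map_one_oneCocycleClass]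
  exact (resH1Hom_id_oneCocycleClass _ hfn β).symm

/-- **Naturality square `ι_* ∘ H¹(F₁) = H¹(F₂) ∘ ι_*`** (`ι : E[m] ↪ E[m²]`) for intertwining maps `F₁` of `E[m]` and
`F₂` of `E[m²]` with `ι ∘ F₁ = F₂ ∘ ι` on points. [cite: SerreGaloisCohomology1997, I.§2.4] -/
theorem map_inclKD_map_one_eq
    (F₁ : (W.torsionGaloisModule (m : ℤ)).toContRepresentation →ⁱL (W.torsionGaloisModule (m : ℤ)).toContRepresentation)
    (F₂ : (W.torsionGaloisModule ((m * m : ℕ) : ℤ)).toContRepresentation →ⁱL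
      (W.torsionGaloisModule ((m * m : ℕ) : ℤ)).toContRepresentation)
    (h : ∀ P, inclKD W m m (F₁ P) = F₂ (inclKD W m m P)) (b : galoisCohomology (W.torsionGaloisModule (m : ℤ)) 1) :
    galoisCohomology.map (inclKD W m m) 1 (galoisCohomology.map F₁ 1 b) =
      galoisCohomology.map F₂ 1 (galoisCohomology.map (inclKD W m m) 1 b) := by
  obtain ⟨β, rfl⟩ := oneCocycleClass_surjective _ b
  simp only [galoisCohomology.map_one_oneCocycleClass]
  exact congrArg (oneCocycleClass _) (Subtype.ext (ContinuousMap.ext fun σ ↦ h _))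

/-- **Naturality square `[m]_* ∘ H¹(F₂) = H¹(F₁) ∘ [m]_*` over a `K`-field `E`** (`[m] : E[m²] → E[m]`, restricted level
maps) for intertwining maps with `[m] ∘ F₂ = F₁ ∘ [m]` on points. [cite: SerreGaloisCohomology1997, I.§2.4] -/
theorem map_mulK_map_one_eq_restrictField (E : Type u) [Field E] [Algebra K E]
    (F₁ : (W.torsionGaloisModule (m : ℤ)).toContRepresentation →ⁱL (W.torsionGaloisModule (m : ℤ)).toContRepresentation)
    (F₂ : (W.torsionGaloisModule ((m * m : ℕ) : ℤ)).toContRepresentation →ⁱL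
      (W.torsionGaloisModule ((m * m : ℕ) : ℤ)).toContRepresentation)
    (h : ∀ Q, mulK W m m (F₂ Q) = F₁ (mulK W m m Q))
    (x : galoisCohomology (GaloisRep.restrictField E (W.torsionGaloisModule ((m * m : ℕ) : ℤ))) 1) :
    galoisCohomology.map ((mulK W m m).restrictField E) 1 (galoisCohomology.map (F₂.restrictField E) 1 x) =
      galoisCohomology.map (F₁.restrictField E) 1 (galoisCohomology.map ((mulK W m m).restrictField E) 1 x) := by
  obtain ⟨β, rfl⟩ := oneCocycleClass_surjective _ x
  simp only [galoisCohomology.map_one_oneCocycleClass]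
  exact congrArg (oneCocycleClass _) (Subtype.ext (ContinuousMap.ext fun σ ↦ h _))

end Functoriality

/-! ## The pair form of McCallum's Lemma 5.3 on first-case data -/

section FirstCase

variable {K : Type u} [Field K] [NumberField K] {W : WeierstrassCurve K} [W.IsElliptic] {m : ℕ} [NeZero m]

-- `Place.Completion (Sum.inr v₀)` vs `v₀.adicCompletion K` (defeq by cases on the place): the unfoldings cost heartbeats
set_option maxHeartbeats 400000 in
/-- ★ **Of the two local Cassels–Tate terms at a Kolyvagin place — over `t` and over `[ω] t` — NOT BOTH vanish** (the
`ℤ[ω]/2^{2κ}`-line form of McCallum's Lemma 5.3, `p = 2`, CM, on Milne's first-case data with `inv` the canonical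
invariant maps).  Level `m = 2^κ`, `κ ≥ 1`; `v₀ ∤ 2` with `E[m²] ⊆ E(K_{v₀})`; `f² + f + 1 = 0` a `Γ_K`-equivariant operator
of `E(K̄)` with a local points map at `K_{v₀}` and points map `fn` on `E[m²]`; `D, D'` first-case data with the same
`b₁`, `ι_* D.b' = t`, `ι_* D'.b' = resH1Hom (id, fn) t`; `2^a • res_{v₀} b₁ ∉ 𝓛_{v₀}`, `2^b • t ∉ ker loc_{v₀}`,
`κ ≤ a + b + 1`. [cite: McCallumLMS1991, §5 Lemma 5.3 and proof of Thm. 5.4] [cite: MilneADT2006, Ch. I §6, proof of Prop. 6.9]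
[cite: Rubin1999, Cor. 5.5] -/
theorem FirstCaseData.localTerm_ne_zero_or_of_line {κ : ℕ} (hκ : 1 ≤ κ) (hm : m = 2 ^ κ)
    (v₀ : HeightOneSpectrum (𝓞 K)) (h2v : ((2 : ℕ) : 𝓞 K) ∉ v₀.asIdeal)
    (e : geomTorsion W ((m * m : ℕ) : ℤ) → geomTorsion W ((m * m : ℕ) : ℤ) → AlgebraicClosure K)
    (hμ : ∀ S T, e S T ^ (m * m) = 1)
    (hadd₁ : ∀ S₁ S₂ T, e (S₁ + S₂) T = e S₁ T * e S₂ T)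
    (hadd₂ : ∀ S T₁ T₂, e S (T₁ + T₂) = e S T₁ * e S T₂)
    (hgal : ∀ (σ : absoluteGaloisGroup K) (S T : geomTorsion W ((m * m : ℕ) : ℤ)), σ • e S T = e (σ • S) (σ • T))
    (halt : ∀ T, e T T = 1) (hnondeg : ∀ T, (∀ S, e S T = 1) → T = 0)
    (f : W.geomPoints →+ W.geomPoints)
    (hfK : ∀ (σ : absoluteGaloisGroup K) (P : W.geomPoints), f (σ • P) = σ • f P)
    (hf : ∀ P, f (f P) + f P + P = 0)
    (fE : localPoints W (Place.Completion (Sum.inr v₀ : Place K)) →+ localPoints W (Place.Completion (Sum.inr v₀ : Place K)))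
    (hfE : ∀ (τ : absoluteGaloisGroup (Place.Completion (Sum.inr v₀ : Place K)))
      (P : localPoints W (Place.Completion (Sum.inr v₀ : Place K))), fE (τ • P) = τ • fE P)
    (hcomp : ∀ P : W.geomPoints, fE (pointsMap W (Place.Completion (Sum.inr v₀ : Place K)) P) =
      pointsMap W (Place.Completion (Sum.inr v₀ : Place K)) (f P))
    (fn : geomTorsion W ((m * m : ℕ) : ℤ) →+ geomTorsion W ((m * m : ℕ) : ℤ))
    (hfnσ : ∀ (g : absoluteGaloisGroup K) (Q : geomTorsion W ((m * m : ℕ) : ℤ)),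
      fn (ContinuousMonoidHom.id _ g • Q) = g • fn Q)
    (hfn : ∀ Q : geomTorsion W ((m * m : ℕ) : ℤ), ((fn Q : geomTorsion W ((m * m : ℕ) : ℤ)) : W.geomPoints) = f Q)
    (hfix : ∀ (g : absoluteGaloisGroup (Place.Completion (Sum.inr v₀ : Place K))) (Q : geomTorsion W ((m * m : ℕ) : ℤ)),
      absGaloisRestrict K (Place.Completion (Sum.inr v₀ : Place K)) g • Q = Q)
    {b₁ : galoisCohomology (W.torsionGaloisModule ((m * m : ℕ) : ℤ)) 1} {t : galH1Torsion W ((m * m : ℕ) : ℤ)}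
    (D D' : FirstCaseData W m) (hD : D.b₁ = b₁) (hD' : D'.b₁ = b₁)
    (hDt : galoisCohomology.map (inclKD W m m) 1 D.b' = t)
    (hD't : galoisCohomology.map (inclKD W m m) 1 D'.b' = resH1Hom (ContinuousMonoidHom.id _) fn hfnσ t)
    {a b : ℕ}
    (hx : ((2 : ℤ) ^ a) • galoisCohomology.res (W.torsionGaloisModule ((m * m : ℕ) : ℤ))
        (Place.Completion (Sum.inr v₀ : Place K)) 1 b₁ ∉
      W.kummerLocalConditionAt ((m * m : ℕ) : ℤ) (Place.Completion (Sum.inr v₀ : Place K)))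
    (ht : ((2 : ℤ) ^ b) • t ∉ W.torsionLocalKer (v₀.adicCompletion K) ((m * m : ℕ) : ℤ))
    (hab : κ ≤ a + b + 1) :
    D.localTerm e hμ hadd₁ hadd₂ hgal (LocalInvariants.canonical K (m * m)) (Sum.inr v₀) ≠ 0 ∨
      D'.localTerm e hμ hadd₁ hadd₂ hgal (LocalInvariants.canonical K (m * m)) (Sum.inr v₀) ≠ 0 := by
  haveI : NeZero (m * m) := ⟨mul_ne_zero (NeZero.ne m) (NeZero.ne m)⟩
  haveI : CharZero (Place.Completion (Sum.inr v₀ : Place K)) := charZero_placeCompletion (K := K) (Sum.inr v₀)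
  haveI : CharZero (v₀.adicCompletion K) := charZero_placeCompletion (K := K) (Sum.inr v₀)
  have hmm : m * m = 2 ^ (2 * κ) := by rw [hm, ← pow_add, two_mul]
  -- the operator data: `fn² + fn + 1 = 0`, the intertwining maps `F₂` (level `m²`) and `F₁` (level `m`) over `f`
  have hrel : ∀ Q, fn (fn Q) + fn Q + Q = 0 := fun Q ↦ Subtype.ext (by
    rw [AddSubgroup.coe_add, AddSubgroup.coe_add, hfn, hfn, ZeroMemClass.coe_zero]; exact hf _)
  let F₂ : (W.torsionGaloisModule ((m * m : ℕ) : ℤ)).toContRepresentation →ⁱL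
      (W.torsionGaloisModule ((m * m : ℕ) : ℤ)).toContRepresentation :=
    { toContinuousLinearMap := ⟨fn.toIntLinearMap, continuous_of_discreteTopology⟩
      isIntertwining' := fun σ ↦ by ext Q; exact congrArg Subtype.val (hfnσ σ Q) }
  have hF₂ : ∀ Q, F₂ Q = fn Q := fun _ ↦ rfl
  let fn₁ : geomTorsion W (m : ℤ) →+ geomTorsion W (m : ℤ) :=
    (f.comp (geomTorsion W (m : ℤ)).subtype).codRestrict _ fun P ↦ by
      rw [mem_geomTorsion_iff, AddMonoidHom.coe_comp, AddSubgroup.coe_subtype, Function.comp_apply, ← map_zsmul,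
        (mem_geomTorsion_iff W _ _).mp P.2, map_zero]
  let F₁ : (W.torsionGaloisModule (m : ℤ)).toContRepresentation →ⁱL (W.torsionGaloisModule (m : ℤ)).toContRepresentation :=
    { toContinuousLinearMap := ⟨fn₁.toIntLinearMap, continuous_of_discreteTopology⟩
      isIntertwining' := fun σ ↦ by
        ext P
        change f ((σ • P : geomTorsion W (m : ℤ)) : W.geomPoints) = σ • f (P : W.geomPoints)
        rw [AddSubgroup.torsionBy.coe_smul, hfK] }
  have hF₁ : ∀ P : geomTorsion W (m : ℤ), ((F₁ P : geomTorsion W (m : ℤ)) : W.geomPoints) = f P := fun _ ↦ rfl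
  have hιF : ∀ P, inclKD W m m (F₁ P) = F₂ (inclKD W m m P) := fun P ↦ Subtype.ext (by
    rw [coe_inclKD_apply, hF₁, hF₂, hfn, coe_inclKD_apply])
  have hmF : ∀ Q, mulK W m m (F₂ Q) = F₁ (mulK W m m Q) := fun Q ↦ Subtype.ext (by
    rw [coe_mulK_apply, hF₂, hfn, hF₁, coe_mulK_apply, map_zsmul])
  -- the local Kummer parametrisation at `v₀` (κ2)
  obtain ⟨κX, hκ, hκs, -, hκlin⟩ := JZero.exists_kummerLocal_line_parametrisation W v₀ h2v (m * m) hmm f hfK hf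
    fE hfE hcomp fn hfn F₂ hF₂ hfix
  obtain ⟨Z, hZ⟩ := hκs _ (D.β'_mem (Sum.inr v₀))
  -- isotropy and maximal isotropy of `𝓛_{v₀}` (tree theorem; #41)
  have hiso : ∀ ⦃x y : galoisCohomology (GaloisRep.restrictField (Place.Completion (Sum.inr v₀ : Place K))
      (W.torsionGaloisModule ((m * m : ℕ) : ℤ))) 1⦄,
      x ∈ W.kummerLocalConditionAt ((m * m : ℕ) : ℤ) (Place.Completion (Sum.inr v₀ : Place K)) →
      y ∈ W.kummerLocalConditionAt ((m * m : ℕ) : ℤ) (Place.Completion (Sum.inr v₀ : Place K)) →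
        weilLocalCup W m (Place.Completion (Sum.inr v₀ : Place K)) e hμ hadd₁ hadd₂ hgal x y = 0 := fun x y hx hy ↦
    weilLocalCup_eq_zero_of_mem_of_fact W m _ e hμ hadd₁ hadd₂ hgal
      (kummerClass_cupProduct_kummerClass_eq_zero_holds _) halt hx hy
  have hperp : ∀ x : galoisCohomology (GaloisRep.restrictField (Place.Completion (Sum.inr v₀ : Place K))
      (W.torsionGaloisModule ((m * m : ℕ) : ℤ))) 1,
      (∀ y ∈ W.kummerLocalConditionAt ((m * m : ℕ) : ℤ) (Place.Completion (Sum.inr v₀ : Place K)),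
        LocalInvariants.canonical K (m * m) (Sum.inr v₀)
          (weilLocalCup W m (Place.Completion (Sum.inr v₀ : Place K)) e hμ hadd₁ hadd₂ hgal x y) = 0) →
      x ∈ W.kummerLocalConditionAt ((m * m : ℕ) : ℤ) (Place.Completion (Sum.inr v₀ : Place K)) := fun x hx' ↦
    mem_kummerLocalConditionAt_of_forall_inv_weilLocalCup_eq_zero v₀ W m (p := 2) (k := 2 * κ) (by omega) hmm h2v
      e hμ hadd₁ hadd₂ hgal halt hnondeg (LocalInvariants.canonical K (m * m) (Sum.inr v₀))
      (LocalInvariants.canonical_isPerfect (K := K) (n := m * m) v₀).1.1 x hx'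
  -- the second local order: `2^{b+κ} • β'_D ≠ 0` (order bookkeeping, `ι_* [m]_* = m`)
  have ht' : galoisCohomology.res (W.torsionGaloisModule ((m * m : ℕ) : ℤ)) (Place.Completion (Sum.inr v₀ : Place K)) 1
      (((2 : ℤ) ^ b) • t) ≠ 0 := fun h ↦
    ht ((mem_torsionLocalKer_iff_res_eq_zero W (v₀.adicCompletion K) (NeZero.ne (m * m)) _).mpr h)
  have hyb : ((2 : ℤ) ^ (b + κ)) • κX Z ≠ 0 := by
    rw [hZ, pow_add, show ((2 : ℤ) ^ κ) = (m : ℤ) by rw [hm]; push_cast; ring]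
    exact mul_zsmul_ne_zero_of_map_mulK_eq_res W m _ (D.map_β' (Sum.inr v₀)) hDt ht'
  -- #40: one of `t(b₁; β_D, κ Z)`, `t(b₁; β_{D'}, κ (fn Z))` is non-zero
  have key := ctLocalTerm_ne_zero_or_of_line W m (Place.Completion (Sum.inr v₀ : Place K)) e hμ hadd₁ hadd₂ hgal
    (LocalInvariants.canonical K (m * m) (Sum.inr v₀)) hiso hperp κX hκ hκs fn hrel hmm b₁
    (D.β_mem (Sum.inr v₀)) (D'.β_mem (Sum.inr v₀)) hx hyb (by omega)
  -- the first is `D.localTerm`, the second `D'.localTerm` (independence of the lift `β'`, `ctLocalTerm_congr_right`)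
  have h1 : D.localTerm e hμ hadd₁ hadd₂ hgal (LocalInvariants.canonical K (m * m)) (Sum.inr v₀) =
      ctLocalTerm W m (Place.Completion (Sum.inr v₀ : Place K)) e hμ hadd₁ hadd₂ hgal
        (LocalInvariants.canonical K (m * m) (Sum.inr v₀)) b₁ (D.β (Sum.inr v₀)) (κX Z) := by
    rw [hZ, ← hD]; rfl
  have hbb : galoisCohomology.res (W.torsionGaloisModule (m : ℤ)) (Place.Completion (Sum.inr v₀ : Place K)) 1 D'.b' =
      galoisCohomology.res (W.torsionGaloisModule (m : ℤ)) (Place.Completion (Sum.inr v₀ : Place K)) 1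
        (galoisCohomology.map F₁ 1 D.b') := by
    apply map_inclKD_restrictField_injective_of_forall_smul_eq W m (Place.Completion (Sum.inr v₀ : Place K)) hfix
    rw [← galoisCohomology.res_map_one, ← galoisCohomology.res_map_one, hD't, map_inclKD_map_one_eq W m F₁ F₂ hιF,
      hDt, map_one_eq_resH1Hom_of_eq W F₂ fn hfnσ hF₂]
  have h2 : D'.localTerm e hμ hadd₁ hadd₂ hgal (LocalInvariants.canonical K (m * m)) (Sum.inr v₀) =
      ctLocalTerm W m (Place.Completion (Sum.inr v₀ : Place K)) e hμ hadd₁ hadd₂ hgal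
        (LocalInvariants.canonical K (m * m) (Sum.inr v₀)) b₁ (D'.β (Sum.inr v₀)) (κX (fn Z)) := by
    rw [← hD']
    refine ctLocalTerm_congr_right _ D'.b₁ ?_ ?_
    · rw [D'.map_β, ← galoisCohomology.res_map_one, D'.map_b₁]
    · rw [D'.map_β', hbb, galoisCohomology.res_map_one, ← D.map_β' (Sum.inr v₀), ← hZ, hκlin Z]
      exact (map_mulK_map_one_eq_restrictField W m _ F₁ F₂ hmF (κX Z)).symm
  rw [h1, h2]
  exact key

/-- ★★ **The (T-L2)′ leaf in its displayed shape «(∀ D over t, t_{v₀}(D) = 0) → (∀ D′ over [ω] t, t_{v₀}(D′) = 0) → False».**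
Same setting as `FirstCaseData.localTerm_ne_zero_or_of_line`; in addition `m • b₁` and `t`, `[ω] t` are Selmer
(`resH1Hom_id_mem_selmerGroup` for the latter), `2^{N'} • t = 0` with `N' ≤ κ`, and `E[m]` has no non-zero `Γ_K`-fixed
point — so that first-case data over `t` and over `[ω] t` EXIST (tree `exists_firstCaseData_of_zsmul_of_map_mulK_eq_zero`,
`map_mulK_eq_zero_of_zsmul_eq_zero`). [cite: McCallumLMS1991, §5 Lemma 5.3 and proof of Thm. 5.4]
[cite: MilneADT2006, Ch. I §6, proof of Prop. 6.9] -/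
theorem FirstCaseData.false_of_forall_localTerm_eq_zero_of_line {κ : ℕ} (hκ : 1 ≤ κ) (hm : m = 2 ^ κ)
    (v₀ : HeightOneSpectrum (𝓞 K)) (h2v : ((2 : ℕ) : 𝓞 K) ∉ v₀.asIdeal)
    (e : geomTorsion W ((m * m : ℕ) : ℤ) → geomTorsion W ((m * m : ℕ) : ℤ) → AlgebraicClosure K)
    (hμ : ∀ S T, e S T ^ (m * m) = 1)
    (hadd₁ : ∀ S₁ S₂ T, e (S₁ + S₂) T = e S₁ T * e S₂ T)
    (hadd₂ : ∀ S T₁ T₂, e S (T₁ + T₂) = e S T₁ * e S T₂)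
    (hgal : ∀ (σ : absoluteGaloisGroup K) (S T : geomTorsion W ((m * m : ℕ) : ℤ)), σ • e S T = e (σ • S) (σ • T))
    (halt : ∀ T, e T T = 1) (hnondeg : ∀ T, (∀ S, e S T = 1) → T = 0)
    (f : W.geomPoints →+ W.geomPoints)
    (hfK : ∀ (σ : absoluteGaloisGroup K) (P : W.geomPoints), f (σ • P) = σ • f P)
    (hf : ∀ P, f (f P) + f P + P = 0)
    (fE : localPoints W (Place.Completion (Sum.inr v₀ : Place K)) →+ localPoints W (Place.Completion (Sum.inr v₀ : Place K)))
    (hfE : ∀ (τ : absoluteGaloisGroup (Place.Completion (Sum.inr v₀ : Place K)))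
      (P : localPoints W (Place.Completion (Sum.inr v₀ : Place K))), fE (τ • P) = τ • fE P)
    (hcomp : ∀ P : W.geomPoints, fE (pointsMap W (Place.Completion (Sum.inr v₀ : Place K)) P) =
      pointsMap W (Place.Completion (Sum.inr v₀ : Place K)) (f P))
    (fn : geomTorsion W ((m * m : ℕ) : ℤ) →+ geomTorsion W ((m * m : ℕ) : ℤ))
    (hfnσ : ∀ (g : absoluteGaloisGroup K) (Q : geomTorsion W ((m * m : ℕ) : ℤ)),
      fn (ContinuousMonoidHom.id _ g • Q) = g • fn Q)
    (hfn : ∀ Q : geomTorsion W ((m * m : ℕ) : ℤ), ((fn Q : geomTorsion W ((m * m : ℕ) : ℤ)) : W.geomPoints) = f Q)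
    (hfix : ∀ (g : absoluteGaloisGroup (Place.Completion (Sum.inr v₀ : Place K))) (Q : geomTorsion W ((m * m : ℕ) : ℤ)),
      absGaloisRestrict K (Place.Completion (Sum.inr v₀ : Place K)) g • Q = Q)
    (hnofixK : ∀ P : geomTorsion W (m : ℤ), (∀ σ : absoluteGaloisGroup K, σ • P = P) → P = 0)
    {b₁ : galoisCohomology (W.torsionGaloisModule ((m * m : ℕ) : ℤ)) 1} {t : galH1Torsion W ((m * m : ℕ) : ℤ)}
    (hb₁ : (m : ℤ) • b₁ ∈ selmerGroup W ((m * m : ℕ) : ℤ)) (htsel : t ∈ selmerGroup W ((m * m : ℕ) : ℤ))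
    (hwtsel : resH1Hom (ContinuousMonoidHom.id _) fn hfnσ t ∈ selmerGroup W ((m * m : ℕ) : ℤ))
    {N' : ℕ} (hN' : N' ≤ κ) (htN : ((2 : ℤ) ^ N') • t = 0) {a b : ℕ}
    (hx : ((2 : ℤ) ^ a) • galoisCohomology.res (W.torsionGaloisModule ((m * m : ℕ) : ℤ))
        (Place.Completion (Sum.inr v₀ : Place K)) 1 b₁ ∉
      W.kummerLocalConditionAt ((m * m : ℕ) : ℤ) (Place.Completion (Sum.inr v₀ : Place K)))
    (ht : ((2 : ℤ) ^ b) • t ∉ W.torsionLocalKer (v₀.adicCompletion K) ((m * m : ℕ) : ℤ))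
    (hab : κ ≤ a + b + 1)
    (h1 : ∀ D : FirstCaseData W m, D.b₁ = b₁ → galoisCohomology.map (inclKD W m m) 1 D.b' = t →
      D.localTerm e hμ hadd₁ hadd₂ hgal (LocalInvariants.canonical K (m * m)) (Sum.inr v₀) = 0)
    (h2 : ∀ D : FirstCaseData W m, D.b₁ = b₁ →
      galoisCohomology.map (inclKD W m m) 1 D.b' = resH1Hom (ContinuousMonoidHom.id _) fn hfnσ t →
      D.localTerm e hμ hadd₁ hadd₂ hgal (LocalInvariants.canonical K (m * m)) (Sum.inr v₀) = 0) :
    False := by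
  -- `[m]_* t = 0`, `[m]_* ([ω] t) = 0` (`2^{N'} t = 0`, `N' ≤ κ`, `E(K)[m] = 0`)
  have hmt' : (m : ℤ) • t = 0 := by
    rw [show (m : ℤ) = (2 : ℤ) ^ (κ - N') * (2 : ℤ) ^ N' by rw [hm, ← pow_add, Nat.sub_add_cancel hN']; push_cast; ring,
      mul_smul, htN, zsmul_zero]
  have hmt : galoisCohomology.map (mulK W m m) 1 t = 0 := map_mulK_eq_zero_of_zsmul_eq_zero W m hnofixK hmt'
  have hmwt' : (m : ℤ) • resH1Hom (ContinuousMonoidHom.id _) fn hfnσ t = 0 := by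
    have h := congrArg (resH1Hom (ContinuousMonoidHom.id _) fn hfnσ) hmt'
    rw [map_zsmul, map_zero] at h
    exact h
  have hmwt : galoisCohomology.map (mulK W m m) 1 (resH1Hom (ContinuousMonoidHom.id _) fn hfnσ t) = 0 :=
    map_mulK_eq_zero_of_zsmul_eq_zero W m hnofixK hmwt'
  obtain ⟨D, hD, hDt⟩ := exists_firstCaseData_of_zsmul_of_map_mulK_eq_zero W m hb₁ htsel hmt
  obtain ⟨D', hD', hD't⟩ := exists_firstCaseData_of_zsmul_of_map_mulK_eq_zero W m hb₁ hwtsel hmwt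
  rcases FirstCaseData.localTerm_ne_zero_or_of_line hκ hm v₀ h2v e hμ hadd₁ hadd₂ hgal halt hnondeg f hfK hf fE hfE
    hcomp fn hfnσ hfn hfix D D' hD hD' hDt hD't hx ht hab with h | h
  · exact h (h1 D hD hDt)
  · exact h (h2 D' hD' hD't)

end FirstCase

end Literature.NumberTheory.EllipticCurves

end
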